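import Literature.AlgebraicGeometry.Motives.HodgeThetaSubalgebraUnitaryLeviKernel
import HarnessLib

/-!
# Raising-space dimension bounds for unitary algebras of constant raising rank: type `(r | 2r)` has at most two,
# type `(2r | b)`, `b ≠ r`, at least three independent raising operators (Ribet 1983 Thm. 3, Lie step — the global
# invariant for the `(9 | 10)` constant-rank stall)

Family `hodge`, layer `Literature/AlgebraicGeometry/Motives` (pure linear algebra over `ℂ`; no geometry). Research
context: cell `pub-hodge-ring2` (HONEST FRAMING: research route conditional on HC_CM; not a corollary; Q11.4-sentence-2
already refuted in dim ≥ 3), Literature lane gen 87, programme R75 «raising-space dimension». UNCONDITIONAL; theorems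
only, no definition, no named fact (D-0026), no `sorry`.

THE PRINT. K. A. Ribet, Amer. J. Math. 105 (1983), Thm. 3 = Gordon's survey Thm. 6.3 (3) [held
`paper:arxiv-alg-geom_9709030` p. 18]: `End⁰ = k` imaginary quadratic acting with coprime multiplicities `(n′, n″)` ⟹
`Hg = U(V, φ)`, `B•(Xⁿ) = D•(Xⁿ)`. The lane replaces Ribet's appeal to the classification of minuscule representations
pair by pair; gens 85–86 reduced every prime cell `≤ 31` but `{15, 16}` to ONE configuration (lit-g86 README §«THE ONE
REMAINING PROBLEM»): an irreducible unitary algebra of type `(9 | 10)` all of whose non-zero raising operators have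
rank `6`. At such a raising `B` the two concrete Levi algebras have types `(3 | 6)` and `(6 | 4)`, both of constant
raising rank `3`, and both admit genuine local models (`𝔤𝔩₃ ⊗ 𝔤𝔩₃` on `ℂ³ ⊗ ℂ³`; `𝔤𝔩₅` on `Λ²ℂ⁵`), so no LOCAL
no-go exists. THIS FILE supplies the GLOBAL invariant that separates the two models: the number of independent raising
operators (`2` for the first, `4` for the second), which must agree for the two Levi algebras of one `B` (both raising
spaces are isomorphic to the space of raising operators commuting with the involution of `B`).

THE SETTING is that of the tree's unitary cores: `𝔊 ⊆ End_ℂ(W)` bracket-closed, an involution `Θ ∈ 𝔊` with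
eigenspaces `P`, `Q`, a Hermitian pairing `s` with `P ⊥ Q`, definite on `P` and on `Q`, for which `𝔊` is
adjoint-closed; raising operators `X` (`ΘX = X = −XΘ`) map `Q → P`.

* §1 **`UnitaryRaisingSpace.exists_mul_adj_mul_eq_smul`** — the tripotent normalisation: a non-zero raising `X` with
  adjoint `C` such that no non-zero raising operator has smaller rank satisfies `XCX = μX`, `μ ≠ 0` (`XCX ∈ 𝔊` by
  `UnitaryThetaCore.iter_mem`; for an eigenvalue `μ` of `XC|_{X(W)}` the operator `(XC − μ)X` has smaller rank).
* §2 **`UnitaryRaisingSpace.exists_finrank_range_sub_smul_lt`** — two operators taking their values on a common subspace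
  `D`, the first injective on `D` and dominating the second: some member of their pencil has rank `< dim D`.
* §3 **`UnitaryConstantRank.exists_pair_span_raise`** — type `(r | 2r)`, constant raising rank `r = dim P`: all
  raising operators lie in the span of two of them. (Peirce splitting `Y = μ⁻¹YCX + (Y − μ⁻¹YCX)` inside `𝔊`, from
  `XCY + YCX = [[X, C], Y] ∈ 𝔊` and `XCY = μY`; the first summand lives on `C(P)` and is proportional to `X`, the
  second lives on `Q ∩ ker X` and is proportional to any fixed non-zero raising operator killing `C(P)`, by §2.)
* §4 **`UnitaryConstantRank.exists_raise_not_mem_span_pair`**, **`exists_three_raise_linearIndependent`** — irreducible,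
  raising ranks in `{0, r}`, `dim P = 2r`, `0 < dim Q ≠ r`: no two raising operators span the raising space, hence
  three independent ones exist (the values of raising operators span `P`, `UnitaryThetaCore.mem_span_raise_apply`, so
  two spanning operators have complementary images; their joint kernel on `Q` is `𝔊`-stable, hence zero, and their sum
  is injective on `Q`, of rank `dim Q ∉ {0, r}`).

CONSEQUENCE (sequel `HodgeThetaSubalgebraUnitaryNineTenCore`): the `(9 | 10)` core, Ribet's theorem at
`(n′, n″) = (9, 10)` — every simple complex abelian `19`-fold with `End⁰ ≠ ℚ` has `B• = D•` on all powers — and the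
`p = 31` cell `{12, 19}`.

## References
* [Ribet1983] K. A. Ribet, *Hodge classes on certain types of abelian varieties*, Amer. J. Math. 105 (1983), Thm. 3.
* [Gordon1997] B. B. Gordon, *A survey of the Hodge conjecture for abelian varieties*, Thm. 6.3 (3), pp. 18–19.
* [Deligne1982HodgeCycles] P. Deligne, *Hodge cycles on abelian varieties*, LNM 900 (1982), I §3 Prop. 3.4, 3.6.
* [GoodmanWallachGTM255] R. Goodman, N. R. Wallach, GTM 255 (2009), §4.1.1 (gradings, centralisers of involutions).
* [HoffmanKunze1971LinearAlgebra] K. Hoffman, R. Kunze, *Linear Algebra* (1971), §3.1 Thm. 2 (rank–nullity), §6.2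
  (characteristic values), §6.7 (projections), §8.3.
-/

noncomputable section

open Module

namespace Literature.AlgebraicGeometry.Motives

namespace HodgeStructure

universe u

variable {W : Type u} [AddCommGroup W] [Module ℂ W]

/-! ### §1 Products of raising operators; the tripotent normalisation at the minimal rank -/

/-- For raising `X, Y ∈ 𝔊` and the adjoint `C` of `X`: `XCY + YCX = [[X, C], Y] ∈ 𝔊` (two raising operators
compose to zero: `XY = X(ΘY) = (XΘ)Y = −XY`, the tree's `SymplecticWitness.mul_eq_zero_of_raise`, inlined to keep the
imports linear-algebraic). [cite: GoodmanWallachGTM255, §4.1.1] [cite: Gordon1997, §6 (proof of Thm. 6.3.3)] -/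
theorem UnitaryRaisingSpace.bracket_bracket_mem {𝔊 : Submodule ℂ (Module.End ℂ W)}
    (hbr : ∀ Y ∈ 𝔊, ∀ Z ∈ 𝔊, Y * Z - Z * Y ∈ 𝔊) {Θ : Module.End ℂ W}
    {X C Y : Module.End ℂ W} (hX : X ∈ 𝔊) (hC : C ∈ 𝔊) (hY : Y ∈ 𝔊)
    (hΘX : Θ * X = X) (hXΘ : X * Θ = -X) (hΘY : Θ * Y = Y) (hYΘ : Y * Θ = -Y) :
    X * C * Y + Y * C * X ∈ 𝔊 := by
  have h := hbr _ (hbr X hX C hC) Y hY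
  have hcomp : ∀ A A' : Module.End ℂ W, A * Θ = -A → Θ * A' = A' → A * A' = 0 := fun A A' hA hA' => by
    have h1 : A * A' = -(A * A') := by
      calc A * A' = A * (Θ * A') := by rw [hA']
        _ = (A * Θ) * A' := by rw [mul_assoc]
        _ = -(A * A') := by rw [hA, neg_mul]
    have h2 : (2 : ℂ) • (A * A') = 0 := by rw [two_smul]; nth_rewrite 2 [h1]; rw [add_neg_cancel]
    exact (smul_eq_zero.1 h2).resolve_left two_ne_zero
  have hXY : X * Y = 0 := hcomp X Y hXΘ hΘY
  have hYX : Y * X = 0 := hcomp Y X hYΘ hΘX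
  have hid : (X * C - C * X) * Y - Y * (X * C - C * X) = X * C * Y + Y * C * X := by
    rw [sub_mul, mul_sub, show C * X * Y = C * (X * Y) by rw [mul_assoc], hXY, mul_zero, sub_zero,
      show Y * (X * C) = (Y * X) * C by rw [mul_assoc], hYX, zero_mul, zero_sub, sub_neg_eq_add, mul_assoc Y C X]
  rwa [hid] at h

/-- **The tripotent normalisation at the minimal rank.** In the unitary setting let `X ∈ 𝔊` be a non-zero raising
operator with adjoint `C`, such that no non-zero raising operator of `𝔊` has smaller rank. Then `XCX = μX` for a
scalar `μ ≠ 0`: `XCX = ½[[X, C], X] ∈ 𝔊` is raising, and for an eigenvalue `μ` of `XC` on `X(W)` the raising operator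
`XCX − μX = (XC − μ)X` has rank `< rk X`, hence vanishes; `μ ≠ 0` because `XC` is injective on `X(W)` (definiteness).
[cite: GoodmanWallachGTM255, §4.1.1] [cite: Gordon1997, §6 (proof of Thm. 6.3.3)]
[cite: HoffmanKunze1971LinearAlgebra, §6.2, §8.3] -/
theorem UnitaryRaisingSpace.exists_mul_adj_mul_eq_smul [FiniteDimensional ℂ W] {𝔊 : Submodule ℂ (Module.End ℂ W)}
    (hbr : ∀ Y ∈ 𝔊, ∀ Z ∈ 𝔊, Y * Z - Z * Y ∈ 𝔊) {Θ : Module.End ℂ W} (hΘΘ : Θ * Θ = 1)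
    {P Q : Submodule ℂ W} (hP : ∀ x, x ∈ P ↔ Θ x = x) (hQ : ∀ x, x ∈ Q ↔ Θ x = -x)
    {s : W → W → ℂ} (hadd : ∀ x y z, s (x + y) z = s x z + s y z) (hsymm : ∀ x y, s y x = starRingEnd ℂ (s x y))
    (hPQ : ∀ p ∈ P, ∀ q ∈ Q, s p q = 0) (hdefP : ∀ p ∈ P, s p p = 0 → p = 0) (hdefQ : ∀ q ∈ Q, s q q = 0 → q = 0)
    {X C : Module.End ℂ W} (hX : X ∈ 𝔊) (hC : C ∈ 𝔊) (hΘX : Θ * X = X) (hXΘ : X * Θ = -X)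
    (hXC : ∀ x y, s (X x) y = s x (C y)) (hX0 : X ≠ 0)
    (hmin : ∀ Y ∈ 𝔊, Θ * Y = Y → Y * Θ = -Y →
      Module.finrank ℂ (LinearMap.range Y) < Module.finrank ℂ (LinearMap.range X) → Y = 0) :
    ∃ μ : ℂ, μ ≠ 0 ∧ X * C * X = μ • X := by
  classical
  obtain ⟨D, -, -, -, -, -, -, -, -, hpos1, hpos2, -, -⟩ :=
    UnitaryThreeCoprime.exists_projector_pair hbr hΘΘ hP hQ hadd hsymm hPQ hdefP hdefQ hX hC hΘX hXΘ hXC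
  have hXX : X * X = 0 := UnitaryThetaCore.mul_self_eq_zero_of_raise hΘX hXΘ
  -- `XCX ∈ 𝔊` is raising
  have hXCXmem : X * C * X ∈ 𝔊 := by
    have h := UnitaryThetaCore.iter_mem hbr hX hC hXX 1
    rwa [pow_one, ← mul_assoc] at h
  -- the restriction of `XC` to `X(W)` and an eigenvalue
  set R : Submodule ℂ W := LinearMap.range X with hRdef
  have hRmap : ∀ v ∈ R, (X * C) v ∈ R := fun v _ => LinearMap.mem_range_self X (C v)
  set A : Module.End ℂ R := (X * C).restrict hRmap with hAdef
  have hRnt : Nontrivial R := by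
    obtain ⟨w, hw⟩ : ∃ w, X w ≠ 0 := by
      by_contra h
      push Not at h
      exact hX0 (LinearMap.ext h)
    exact ⟨⟨⟨X w, LinearMap.mem_range_self X w⟩, 0, fun h => hw (congrArg Subtype.val h)⟩⟩
  obtain ⟨μ, hμ⟩ := Module.End.exists_eigenvalue A
  obtain ⟨v, hv, hv0⟩ := hμ.exists_hasEigenvector
  rw [Module.End.mem_eigenspace_iff] at hv
  -- the raising operator `XCX − μX` has smaller rank, hence vanishes
  set Y : Module.End ℂ W := X * C * X - μ • X with hYdef
  have hYmem : Y ∈ 𝔊 := Submodule.sub_mem _ hXCXmem (Submodule.smul_mem _ _ hX)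
  have hΘY : Θ * Y = Y := by rw [hYdef, mul_sub, mul_smul_comm, ← mul_assoc, ← mul_assoc, hΘX]
  have hYΘ : Y * Θ = -Y := by
    rw [hYdef, sub_mul, smul_mul_assoc, mul_assoc (X * C) X Θ, hXΘ, mul_neg, smul_neg]
    abel
  have hYapply : ∀ w, Y w = ((A - μ • 1) ⟨X w, LinearMap.mem_range_self X w⟩ : R) := fun w => by
    simp only [hYdef, hAdef, LinearMap.sub_apply, LinearMap.smul_apply, Module.End.mul_apply, Module.End.one_apply,
      Submodule.coe_sub, Submodule.coe_smul, LinearMap.coe_restrict_apply]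
  have hYrange : LinearMap.range Y ≤ (LinearMap.range (A - μ • 1)).map R.subtype := by
    rintro _ ⟨w, rfl⟩
    exact ⟨(A - μ • 1) ⟨X w, LinearMap.mem_range_self X w⟩, LinearMap.mem_range_self _ _, (hYapply w).symm⟩
  have hker : LinearMap.ker (A - μ • 1) ≠ ⊥ := by
    intro h
    have hmem : v ∈ LinearMap.ker (A - μ • 1) := by
      rw [LinearMap.mem_ker, LinearMap.sub_apply, LinearMap.smul_apply, Module.End.one_apply, hv, sub_self]
    rw [h, Submodule.mem_bot] at hmem
    exact hv0 hmem
  have hlt : Module.finrank ℂ (LinearMap.range Y) < Module.finrank ℂ R := by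
    have h1 := Submodule.finrank_mono hYrange
    have h2 : Module.finrank ℂ ((LinearMap.range (A - μ • 1)).map R.subtype) =
        Module.finrank ℂ (LinearMap.range (A - μ • 1)) :=
      LinearEquiv.finrank_eq (Submodule.equivMapOfInjective _ R.injective_subtype _).symm
    have h3 := LinearMap.finrank_range_add_finrank_ker (A - μ • 1)
    have h4 : 0 < Module.finrank ℂ (LinearMap.ker (A - μ • 1)) := by
      rw [Module.finrank_pos_iff_exists_ne_zero]
      obtain ⟨x, hx, hx0⟩ := (Submodule.ne_bot_iff _).1 hker
      exact ⟨⟨x, hx⟩, fun h => hx0 (congrArg Subtype.val h)⟩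
    omega
  have hY0 : Y = 0 := hmin Y hYmem hΘY hYΘ hlt
  refine ⟨μ, fun hμ0 => hX0 ?_, (sub_eq_zero.1 (hYdef ▸ hY0 : X * C * X - μ • X = 0))⟩
  -- `μ = 0` would give `XCX = 0`, hence `X = 0` by the two definiteness facts
  have hXCX : X * C * X = 0 := by
    have h := sub_eq_zero.1 (hYdef ▸ hY0 : X * C * X - μ • X = 0)
    rw [h, hμ0, zero_smul]
  refine LinearMap.ext fun w => ?_
  have h1 : X (C (X w)) = 0 := by
    have h := congrArg (fun T : Module.End ℂ W => T w) hXCX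
    simpa only [Module.End.mul_apply, LinearMap.zero_apply] using h
  have hXwP : X w ∈ P := (hP _).2 (by rw [← Module.End.mul_apply, hΘX])
  rw [LinearMap.zero_apply]
  exact hpos2 w (hpos1 (X w) hXwP h1)

/-! ### §2 Two operators living on a common subspace: the rank of a pencil drops -/

/-- **Rank drop along a pencil.** Let `X, Y ∈ End(W)` take all their values already on a subspace `D ≠ 0`, with `X`
injective on `D` and `Y(D) ⊆ X(D)`. Then `rk(Y − cX) < dim D` for some scalar `c` (an eigenvalue of `X|_D⁻¹ ∘ Y|_D`).
[cite: HoffmanKunze1971LinearAlgebra, §6.2 Thm. 1, §3.1 Thm. 2] -/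
theorem UnitaryRaisingSpace.exists_finrank_range_sub_smul_lt [FiniteDimensional ℂ W] (X Y : Module.End ℂ W)
    (D : Submodule ℂ W) (hD : D ≠ ⊥) (hval : ∀ w, ∃ d ∈ D, X w = X d ∧ Y w = Y d)
    (hXinj : ∀ d ∈ D, X d = 0 → d = 0) (hYD : ∀ d ∈ D, ∃ d' ∈ D, Y d = X d') :
    ∃ c : ℂ, Module.finrank ℂ (LinearMap.range (Y - c • X)) < Module.finrank ℂ D := by
  classical
  set f : D →ₗ[ℂ] W := X.domRestrict D with hfdef
  have hfinj : Function.Injective f := by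
    rw [← LinearMap.ker_eq_bot, LinearMap.ker_eq_bot']
    intro d hd
    exact Subtype.ext (hXinj d d.2 hd)
  set e : D ≃ₗ[ℂ] LinearMap.range f := LinearEquiv.ofInjective f hfinj with hedef
  have hgD : ∀ d : D, Y (d : W) ∈ LinearMap.range f := fun d => by
    obtain ⟨d', hd', h⟩ := hYD d d.2
    exact ⟨⟨d', hd'⟩, h.symm⟩
  set g : D →ₗ[ℂ] LinearMap.range f := LinearMap.codRestrict (LinearMap.range f) (Y.domRestrict D) hgD with hgdef
  set G : Module.End ℂ D := e.symm.toLinearMap ∘ₗ g with hGdef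
  have hDnt : Nontrivial D := by
    obtain ⟨x, hx, hx0⟩ := (Submodule.ne_bot_iff _).1 hD
    exact ⟨⟨⟨x, hx⟩, 0, fun h => hx0 (congrArg Subtype.val h)⟩⟩
  obtain ⟨c, hc⟩ := Module.End.exists_eigenvalue G
  obtain ⟨v, hv, hv0⟩ := hc.exists_hasEigenvector
  rw [Module.End.mem_eigenspace_iff] at hv
  -- `Y v = c • X v`
  have hYv : Y (v : W) = c • X (v : W) := by
    have h1 : e (G v) = g v := by rw [hGdef, LinearMap.comp_apply, LinearEquiv.coe_toLinearMap, LinearEquiv.apply_symm_apply]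
    rw [hv, map_smul] at h1
    have h2 := congrArg (fun x : LinearMap.range f => (x : W)) h1
    simp only [Submodule.coe_smul, hedef, LinearEquiv.ofInjective_apply, hgdef, LinearMap.codRestrict_apply,
      LinearMap.domRestrict_apply, hfdef] at h2
    exact h2.symm
  refine ⟨c, ?_⟩
  -- the pencil member `Y − cX` lives on `D` and kills `v ≠ 0`
  have hrange : LinearMap.range (Y - c • X) ≤ D.map (Y - c • X) := by
    rintro _ ⟨w, rfl⟩
    obtain ⟨d, hd, hXw, hYw⟩ := hval w
    exact ⟨d, hd, by simp only [LinearMap.sub_apply, LinearMap.smul_apply, hXw, hYw]⟩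
  have h1 := Submodule.finrank_mono hrange
  have h2 := LinearMap.finrank_range_add_finrank_ker ((Y - c • X).domRestrict D)
  rw [LinearMap.range_domRestrict] at h2
  have h3 : 0 < Module.finrank ℂ (LinearMap.ker ((Y - c • X).domRestrict D)) := by
    rw [Module.finrank_pos_iff_exists_ne_zero]
    refine ⟨⟨v, ?_⟩, fun h => hv0 (congrArg Subtype.val h)⟩
    rw [LinearMap.mem_ker, LinearMap.domRestrict_apply, LinearMap.sub_apply, LinearMap.smul_apply, hYv, sub_self]
  omega

/-! ### §3 Constant rank `r = dim P`, `dim Q = 2r`: the raising operators span a plane at most -/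

/-- **Type `(r | 2r)` with constant raising rank `r`: at most two independent raising operators.** In the unitary
setting with `dim P = r > 0`, `dim Q = 2r`, suppose every non-zero raising operator of `𝔊` has rank `r`. Then all
raising operators of `𝔊` lie in the span of two of them. (For a non-zero raising `X` with adjoint `C`, normalised by
`XCX = μX`: every raising `Y` splits inside `𝔊` as `μ⁻¹YCX + (Y − μ⁻¹YCX)` — the first summand lives on `C(P)` and is
a multiple of `X`, the second lives on `Q ∩ ker X` and is a multiple of any fixed non-zero raising operator killing
`C(P)` — two injective maps between `r`-dimensional spaces are proportional once every member of their pencil is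
injective or zero.) [cite: GoodmanWallachGTM255, §4.1.1] [cite: Gordon1997, §6 (proof of Thm. 6.3.3)]
[cite: HoffmanKunze1971LinearAlgebra, §6.2, §6.7, §8.3] -/
theorem UnitaryConstantRank.exists_pair_span_raise [FiniteDimensional ℂ W] {𝔊 : Submodule ℂ (Module.End ℂ W)}
    (hbr : ∀ Y ∈ 𝔊, ∀ Z ∈ 𝔊, Y * Z - Z * Y ∈ 𝔊) {Θ : Module.End ℂ W} (hΘ : Θ ∈ 𝔊) (hΘΘ : Θ * Θ = 1)
    {P Q : Submodule ℂ W} (hP : ∀ x, x ∈ P ↔ Θ x = x) (hQ : ∀ x, x ∈ Q ↔ Θ x = -x)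
    {r : ℕ} (hr : 0 < r) (hPr : Module.finrank ℂ P = r) (hQr : Module.finrank ℂ Q = r + r)
    {s : W → W → ℂ} (hadd : ∀ x y z, s (x + y) z = s x z + s y z) (hsymm : ∀ x y, s y x = starRingEnd ℂ (s x y))
    (hPQ : ∀ p ∈ P, ∀ q ∈ Q, s p q = 0) (hdefP : ∀ p ∈ P, s p p = 0 → p = 0) (hdefQ : ∀ q ∈ Q, s q q = 0 → q = 0)
    (hadj : ∀ X ∈ 𝔊, ∃ Y ∈ 𝔊, ∀ x y, s (X x) y = s x (Y y))
    (hS : ∀ Y ∈ 𝔊, Θ * Y = Y → Y * Θ = -Y → Y ≠ 0 → Module.finrank ℂ (LinearMap.range Y) = r) :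
    ∃ X₁ X₂ : Module.End ℂ W, ∀ Y ∈ 𝔊, Θ * Y = Y → Y * Θ = -Y → Y ∈ Submodule.span ℂ {X₁, X₂} := by
  classical
  have hraiseval : ∀ Z : Module.End ℂ W, Θ * Z = Z → ∀ w, Z w ∈ P := fun Z hΘZ w =>
    (hP _).2 (by rw [← Module.End.mul_apply, hΘZ])
  have hraiseP : ∀ Z : Module.End ℂ W, Z * Θ = -Z → ∀ p ∈ P, Z p = 0 := fun Z hZΘ p hp => by
    have h : Z p = -(Z p) := by
      conv_lhs => rw [← (hP p).1 hp]
      rw [← Module.End.mul_apply, hZΘ, LinearMap.neg_apply]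
    have h2 : (2 : ℂ) • Z p = 0 := by rw [two_smul]; nth_rewrite 2 [h]; rw [add_neg_cancel]
    exact (smul_eq_zero.1 h2).resolve_left two_ne_zero
  by_cases hex : ∃ X ∈ 𝔊, Θ * X = X ∧ X * Θ = -X ∧ X ≠ 0
  swap
  · push Not at hex
    refine ⟨0, 0, fun Y hY hΘY hYΘ => ?_⟩
    rw [hex Y hY hΘY hYΘ]
    exact Submodule.zero_mem _
  obtain ⟨X, hX, hΘX, hXΘ, hX0⟩ := hex
  have hrX : Module.finrank ℂ (LinearMap.range X) = r := hS X hX hΘX hXΘ hX0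
  obtain ⟨C, hC, ι, -, hXC, hΘC, hCΘ, -, -, -, -, -, -, -, -, -, -, -, hfinP₀, hfinQ₀, hfinQU, hrangeP, hmapCQ, -, -⟩ :=
    UnitaryLeviKernel.exists_involution hbr hΘ hΘΘ hP hQ hadd hsymm hPQ hdefP hdefQ hadj hX hΘX hXΘ
  obtain ⟨D, -, -, -, -, -, -, -, -, hpos1, hpos2, hdec, -⟩ :=
    UnitaryThreeCoprime.exists_projector_pair hbr hΘΘ hP hQ hadd hsymm hPQ hdefP hdefQ hX hC hΘX hXΘ hXC
  have hrangeX : LinearMap.range X = P :=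
    Submodule.eq_of_le_of_finrank_eq hrangeP (by rw [hrX, hPr])
  -- the tripotent normalisation
  obtain ⟨μ, hμ0, hXCX⟩ := UnitaryRaisingSpace.exists_mul_adj_mul_eq_smul hbr hΘΘ hP hQ hadd hsymm hPQ hdefP hdefQ
    hX hC hΘX hXΘ hXC hX0 fun Y hY hΘY hYΘ hlt => by
      by_contra hY0
      have := hS Y hY hΘY hYΘ hY0
      omega
  -- the two pieces of `Q`
  set Dc : Submodule ℂ W := P.map C with hDcdef
  set E : Submodule ℂ W := Q ⊓ LinearMap.ker X with hEdef
  have hfinDc : Module.finrank ℂ Dc = r := by rw [hDcdef, hfinQU, hrX]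
  have hfinE : Module.finrank ℂ E = r := by omega
  have hDcne : Dc ≠ ⊥ := fun h => by
    rw [h, finrank_bot] at hfinDc
    omega
  have hEne : E ≠ ⊥ := fun h => by
    rw [h, finrank_bot] at hfinE
    omega
  have hXCXv : ∀ v, X (C (X v)) = μ • X v := fun v => by
    have h := congrArg (fun T : Module.End ℂ W => T v) hXCX
    simpa only [Module.End.mul_apply, LinearMap.smul_apply] using h
  have hCXD : ∀ d ∈ Dc, C (X d) = μ • d := by
    rintro _ ⟨p, hp, rfl⟩
    obtain ⟨v, hv⟩ : p ∈ LinearMap.range X := by rw [hrangeX]; exact hp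
    rw [← hv, hXCXv, map_smul]
  have hXE : ∀ e ∈ E, X e = 0 := fun e he => LinearMap.mem_ker.1 (Submodule.mem_inf.1 he).2
  have hPX : ∀ p ∈ P, ∃ d ∈ Dc, p = X d := fun p hp => by
    obtain ⟨v, hv⟩ : p ∈ LinearMap.range X := by rw [hrangeX]; exact hp
    refine ⟨μ⁻¹ • C (X v), Submodule.smul_mem _ _ ⟨X v, hraiseval X hΘX v, rfl⟩, ?_⟩
    rw [map_smul, hXCXv, smul_smul, inv_mul_cancel₀ hμ0, one_smul, hv]
  -- a fixed non-zero raising operator killing `C(P)`, if any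
  have hKex : ∃ Z₀ : Module.End ℂ W, (Z₀ = 0 ∨ (Z₀ ∈ 𝔊 ∧ Θ * Z₀ = Z₀ ∧ Z₀ * Θ = -Z₀ ∧ Z₀ ≠ 0 ∧ ∀ d ∈ Dc, Z₀ d = 0)) ∧
      ∀ Z ∈ 𝔊, Θ * Z = Z → Z * Θ = -Z → (∀ d ∈ Dc, Z d = 0) → Z ∈ Submodule.span ℂ {Z₀} := by
    by_cases hK : ∃ Z₀ ∈ 𝔊, Θ * Z₀ = Z₀ ∧ Z₀ * Θ = -Z₀ ∧ Z₀ ≠ 0 ∧ ∀ d ∈ Dc, Z₀ d = 0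
    · obtain ⟨Z₀, hZ₀, hΘZ₀, hZ₀Θ, hZ₀0, hZ₀D⟩ := hK
      refine ⟨Z₀, Or.inr ⟨hZ₀, hΘZ₀, hZ₀Θ, hZ₀0, hZ₀D⟩, fun Z hZ hΘZ hZΘ hZD => ?_⟩
      have hrZ₀ : Module.finrank ℂ (LinearMap.range Z₀) = r := hS Z₀ hZ₀ hΘZ₀ hZ₀Θ hZ₀0
      -- values on `E`
      have hvalE : ∀ T : Module.End ℂ W, (∀ p ∈ P, T p = 0) → (∀ d ∈ Dc, T d = 0) →
          ∀ w, ∃ e ∈ E, T w = T e := by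
        intro T hTP hTD w
        obtain ⟨a, ha, b, hb, c, hc, d, hd, hw⟩ := hdec w
        refine ⟨d, hd, ?_⟩
        rw [hw, map_add, map_add, map_add, hTP a (hrangeP ha), hTP b (Submodule.mem_inf.1 hb).1, hTD c hc,
          zero_add, zero_add, zero_add]
      have hrangeZ₀E : LinearMap.range Z₀ = E.map Z₀ := by
        refine le_antisymm ?_ LinearMap.map_le_range
        rintro _ ⟨w, rfl⟩
        obtain ⟨e, he, h⟩ := hvalE Z₀ (hraiseP Z₀ hZ₀Θ) hZ₀D w
        exact ⟨e, he, h.symm⟩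
      have hZ₀inj : ∀ e ∈ E, Z₀ e = 0 → e = 0 := by
        have h2 := LinearMap.finrank_range_add_finrank_ker (Z₀.domRestrict E)
        rw [LinearMap.range_domRestrict, ← hrangeZ₀E, hrZ₀, hfinE] at h2
        have hker : LinearMap.ker (Z₀.domRestrict E) = ⊥ := Submodule.finrank_eq_zero.1 (by omega)
        intro e he hZe
        have : (⟨e, he⟩ : E) ∈ LinearMap.ker (Z₀.domRestrict E) := by
          rw [LinearMap.mem_ker, LinearMap.domRestrict_apply]; exact hZe
        rw [hker, Submodule.mem_bot] at this
        exact congrArg Subtype.val this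
      have hrangeZ₀ : LinearMap.range Z₀ = P :=
        Submodule.eq_of_le_of_finrank_eq (by rintro _ ⟨w, rfl⟩; exact hraiseval Z₀ hΘZ₀ w) (by rw [hrZ₀, hPr])
      have hZE : ∀ e ∈ E, ∃ e' ∈ E, Z e = Z₀ e' := fun e he => by
        obtain ⟨e', he', h⟩ : Z e ∈ E.map Z₀ := by rw [← hrangeZ₀E, hrangeZ₀]; exact hraiseval Z hΘZ e
        exact ⟨e', he', h.symm⟩
      obtain ⟨c, hc⟩ := UnitaryRaisingSpace.exists_finrank_range_sub_smul_lt Z₀ Z E hEne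
        (fun w => by
          obtain ⟨a, ha, b, hb, c, hc, d, hd, hw⟩ := hdec w
          refine ⟨d, hd, ?_, ?_⟩
          · rw [hw, map_add, map_add, map_add, hraiseP Z₀ hZ₀Θ a (hrangeP ha),
              hraiseP Z₀ hZ₀Θ b (Submodule.mem_inf.1 hb).1, hZ₀D c hc, zero_add, zero_add, zero_add]
          · rw [hw, map_add, map_add, map_add, hraiseP Z hZΘ a (hrangeP ha),
              hraiseP Z hZΘ b (Submodule.mem_inf.1 hb).1, hZD c hc, zero_add, zero_add, zero_add])
        hZ₀inj hZE
      rw [hfinE] at hc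
      have hmem : Z - c • Z₀ ∈ 𝔊 := Submodule.sub_mem _ hZ (Submodule.smul_mem _ _ hZ₀)
      have h0 : Z - c • Z₀ = 0 := by
        by_contra hne
        have := hS _ hmem (by rw [mul_sub, mul_smul_comm, hΘZ, hΘZ₀])
          (by rw [sub_mul, smul_mul_assoc, hZΘ, hZ₀Θ, smul_neg]; abel) hne
        omega
      rw [sub_eq_zero] at h0
      rw [h0]
      exact Submodule.smul_mem _ _ (Submodule.subset_span rfl)
    · push Not at hK
      refine ⟨0, Or.inl rfl, fun Z hZ hΘZ hZΘ hZD => ?_⟩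
      by_cases hZ0 : Z = 0
      · rw [hZ0]; exact Submodule.zero_mem _
      · obtain ⟨d, hd, hne⟩ := hK Z hZ hΘZ hZΘ hZ0
        exact (hne (hZD d hd)).elim
  obtain ⟨Z₀, -, hKspan⟩ := hKex
  refine ⟨X, Z₀, fun Y hY hΘY hYΘ => ?_⟩
  -- the Peirce splitting `Y = μ⁻¹ YCX + (Y − μ⁻¹ YCX)` inside `𝔊`
  have hT := UnitaryRaisingSpace.bracket_bracket_mem hbr hX hC hY hΘX hXΘ hΘY hYΘ
  have hXCY : X * C * Y = μ • Y := by
    refine LinearMap.ext fun w => ?_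
    obtain ⟨v, hv⟩ : Y w ∈ LinearMap.range X := by rw [hrangeX]; exact hraiseval Y hΘY w
    rw [LinearMap.smul_apply, Module.End.mul_apply, Module.End.mul_apply, ← hv, hXCXv]
  have hYCXmem : Y * C * X ∈ 𝔊 := by
    have h : Y * C * X = (X * C * Y + Y * C * X) - μ • Y := by rw [hXCY, add_sub_cancel_left]
    rw [h]
    exact Submodule.sub_mem _ hT (Submodule.smul_mem _ _ hY)
  obtain ⟨Y₁, hY₁def⟩ : ∃ Y₁ : Module.End ℂ W, Y₁ = μ⁻¹ • (Y * C * X) := ⟨_, rfl⟩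
  have hY₁mem : Y₁ ∈ 𝔊 := hY₁def ▸ Submodule.smul_mem _ _ hYCXmem
  have hΘY₁ : Θ * Y₁ = Y₁ := by rw [hY₁def, mul_smul_comm, ← mul_assoc, ← mul_assoc, hΘY]
  have hY₁Θ : Y₁ * Θ = -Y₁ := by rw [hY₁def, smul_mul_assoc, mul_assoc, hXΘ, mul_neg, smul_neg]
  have hY₁D : ∀ d ∈ Dc, Y₁ d = Y d := fun d hd => by
    rw [hY₁def, LinearMap.smul_apply, Module.End.mul_apply, Module.End.mul_apply, hCXD d hd, map_smul, smul_smul,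
      inv_mul_cancel₀ hμ0, one_smul]
  have hY₁E : ∀ e ∈ E, Y₁ e = 0 := fun e he => by
    rw [hY₁def, LinearMap.smul_apply, Module.End.mul_apply, Module.End.mul_apply, hXE e he, map_zero, map_zero,
      smul_zero]
  -- `Y₁` is a multiple of `X`
  have hY₁span : Y₁ ∈ Submodule.span ℂ {X} := by
    obtain ⟨c, hc⟩ := UnitaryRaisingSpace.exists_finrank_range_sub_smul_lt X Y₁ Dc hDcne
      (fun w => by
        obtain ⟨a, ha, b, hb, c, hc, d, hd, hw⟩ := hdec w
        refine ⟨c, hc, ?_, ?_⟩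
        · rw [hw, map_add, map_add, map_add, hraiseP X hXΘ a (hrangeP ha), hraiseP X hXΘ b (Submodule.mem_inf.1 hb).1,
            hXE d hd, zero_add, zero_add, add_zero]
        · rw [hw, map_add, map_add, map_add, hraiseP Y₁ hY₁Θ a (hrangeP ha),
            hraiseP Y₁ hY₁Θ b (Submodule.mem_inf.1 hb).1, hY₁E d hd, zero_add, zero_add, add_zero])
      (fun d hd hXd => by
        obtain ⟨p, hp, rfl⟩ := hd
        exact hpos1 p hp hXd)
      (fun d hd => by
        obtain ⟨d', hd', h⟩ := hPX (Y₁ d) (hraiseval Y₁ hΘY₁ d)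
        exact ⟨d', hd', h⟩)
    rw [hfinDc] at hc
    have hmem : Y₁ - c • X ∈ 𝔊 := Submodule.sub_mem _ hY₁mem (Submodule.smul_mem _ _ hX)
    have h0 : Y₁ - c • X = 0 := by
      by_contra hne
      have := hS _ hmem (by rw [mul_sub, mul_smul_comm, hΘY₁, hΘX])
        (by rw [sub_mul, smul_mul_assoc, hY₁Θ, hXΘ, smul_neg]; abel) hne
      omega
    rw [sub_eq_zero] at h0
    rw [h0]
    exact Submodule.smul_mem _ _ (Submodule.subset_span rfl)
  -- `Y − Y₁` kills `C(P)`, hence is a multiple of `Z₀`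
  have hΘY₂ : Θ * (Y - Y₁) = Y - Y₁ := by rw [mul_sub, hΘY, hΘY₁]
  have hY₂Θ : (Y - Y₁) * Θ = -(Y - Y₁) := by rw [sub_mul, hYΘ, hY₁Θ]; abel
  have hY₂D : ∀ d ∈ Dc, (Y - Y₁) d = 0 := fun d hd => by rw [LinearMap.sub_apply, hY₁D d hd, sub_self]
  have hY₂span : Y - Y₁ ∈ Submodule.span ℂ {Z₀} := hKspan (Y - Y₁) (Submodule.sub_mem _ hY hY₁mem) hΘY₂ hY₂Θ hY₂D
  have hmem : Y₁ + (Y - Y₁) ∈ Submodule.span ℂ ({X, Z₀} : Set (Module.End ℂ W)) :=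
    Submodule.add_mem _ (Submodule.span_mono (Set.singleton_subset_iff.2 (Set.mem_insert X {Z₀})) hY₁span)
      (Submodule.span_mono (Set.subset_insert X {Z₀}) hY₂span)
  rwa [add_sub_cancel] at hmem

/-! ### §4 Constant rank `r`, `dim P = 2r`, `dim Q ≠ r`, irreducible: three independent raising operators -/

/-- **Two raising operators never suffice** (irreducible unitary algebra, raising ranks in `{0, r}`, `dim P = 2r > 0`,
`0 < dim Q ≠ r`). If every raising operator of `𝔊` were a combination of two raising `X₁, X₂ ∈ 𝔊`, then the values of
raising operators — which span `P` (`UnitaryThetaCore.mem_span_raise_apply`) — would lie in `X₁(W) + X₂(W)`, so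
`X₁(W) ⊕ X₂(W) = P`; the joint kernel `Q ∩ ker X₁ ∩ ker X₂` is `𝔊`-stable, hence zero, so `X₁ + X₂` is injective on
`Q` and has rank `dim Q ∉ {0, r}`. [cite: Gordon1997, §6 (proof of Thm. 6.3.3, p. 19)] [cite: Ribet1983, Thm. 3]
[cite: GoodmanWallachGTM255, §4.1.1] [cite: HoffmanKunze1971LinearAlgebra, §3.1 Thm. 2, §6.7] -/
theorem UnitaryConstantRank.exists_raise_not_mem_span_pair [FiniteDimensional ℂ W] {𝔊 : Submodule ℂ (Module.End ℂ W)}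
    (hbr : ∀ Y ∈ 𝔊, ∀ Z ∈ 𝔊, Y * Z - Z * Y ∈ 𝔊)
    (hirr : ∀ U : Submodule ℂ W, (∀ A ∈ 𝔊, ∀ u ∈ U, A u ∈ U) → U = ⊥ ∨ U = ⊤)
    {Θ : Module.End ℂ W} (hΘ : Θ ∈ 𝔊) (hΘΘ : Θ * Θ = 1)
    {P Q : Submodule ℂ W} (hP : ∀ x, x ∈ P ↔ Θ x = x) (hQ : ∀ x, x ∈ Q ↔ Θ x = -x)
    {r : ℕ} (hr : 0 < r) (hPr : Module.finrank ℂ P = r + r) (hQ0 : 0 < Module.finrank ℂ Q)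
    (hQr : Module.finrank ℂ Q ≠ r)
    (hS : ∀ Y ∈ 𝔊, Θ * Y = Y → Y * Θ = -Y →
      Module.finrank ℂ (LinearMap.range Y) = 0 ∨ Module.finrank ℂ (LinearMap.range Y) = r)
    {X₁ X₂ : Module.End ℂ W} (hX₁ : X₁ ∈ 𝔊) (hΘX₁ : Θ * X₁ = X₁) (hX₁Θ : X₁ * Θ = -X₁)
    (hX₂ : X₂ ∈ 𝔊) (hΘX₂ : Θ * X₂ = X₂) (hX₂Θ : X₂ * Θ = -X₂) :
    ∃ Y ∈ 𝔊, Θ * Y = Y ∧ Y * Θ = -Y ∧ Y ∉ Submodule.span ℂ {X₁, X₂} := by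
  classical
  have hΘΘv : ∀ v, Θ (Θ v) = v := fun v => by rw [← Module.End.mul_apply, hΘΘ, Module.End.one_apply]
  have hraiseval : ∀ Z : Module.End ℂ W, Θ * Z = Z → ∀ w, Z w ∈ P := fun Z hΘZ w =>
    (hP _).2 (by rw [← Module.End.mul_apply, hΘZ])
  have hraiseP : ∀ Z : Module.End ℂ W, Z * Θ = -Z → ∀ p ∈ P, Z p = 0 := fun Z hZΘ p hp => by
    have h : Z p = -(Z p) := by
      conv_lhs => rw [← (hP p).1 hp]
      rw [← Module.End.mul_apply, hZΘ, LinearMap.neg_apply]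
    have h2 : (2 : ℂ) • Z p = 0 := by rw [two_smul]; nth_rewrite 2 [h]; rw [add_neg_cancel]
    exact (smul_eq_zero.1 h2).resolve_left two_ne_zero
  have hlowerQ : ∀ Z : Module.End ℂ W, Z * Θ = Z → ∀ q ∈ Q, Z q = 0 := fun Z hZΘ q hq => by
    have h : Z q = -(Z q) := by
      conv_lhs => rw [← hZΘ, Module.End.mul_apply, (hQ q).1 hq, map_neg]
    have h2 : (2 : ℂ) • Z q = 0 := by rw [two_smul]; nth_rewrite 2 [h]; rw [add_neg_cancel]
    exact (smul_eq_zero.1 h2).resolve_left two_ne_zero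
  by_contra hall
  push Not at hall
  -- every raising operator is a combination of `X₁`, `X₂`
  have hcomb : ∀ Y ∈ 𝔊, Θ * Y = Y → Y * Θ = -Y → ∃ a b : ℂ, Y = a • X₁ + b • X₂ := by
    intro Y hY hΘY hYΘ
    have h := hall Y hY hΘY hYΘ
    rw [Submodule.mem_span_pair] at h
    obtain ⟨a, b, h⟩ := h
    exact ⟨a, b, h.symm⟩
  -- (i) `P ≤ X₁(W) ⊔ X₂(W)`, hence both ranks are `r` and the images are independent
  obtain ⟨⟨q₀, hq₀⟩, hq₀0⟩ := Module.finrank_pos_iff_exists_ne_zero.1 hQ0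
  have hQ0' : ∃ q : W, q ≠ 0 ∧ Θ q = -q := ⟨q₀, fun h => hq₀0 (Subtype.ext h), (hQ q₀).1 hq₀⟩
  have hPle : P ≤ LinearMap.range X₁ ⊔ LinearMap.range X₂ := by
    intro y hy
    have h := UnitaryThetaCore.mem_span_raise_apply hbr hirr hΘ hΘΘ hQ0' ((hP y).1 hy)
    refine (Submodule.span_le.2 ?_) h
    rintro _ ⟨B, hB, hΘB, hBΘ, w, rfl⟩
    obtain ⟨a, b, hBab⟩ := hcomb B hB hΘB hBΘ
    rw [hBab, LinearMap.add_apply, LinearMap.smul_apply, LinearMap.smul_apply]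
    exact Submodule.add_mem _ (Submodule.mem_sup_left (Submodule.smul_mem _ _ (LinearMap.mem_range_self X₁ w)))
      (Submodule.mem_sup_right (Submodule.smul_mem _ _ (LinearMap.mem_range_self X₂ w)))
  have hle1 : Module.finrank ℂ (LinearMap.range X₁) ≤ r := by
    rcases hS X₁ hX₁ hΘX₁ hX₁Θ with h | h <;> omega
  have hle2 : Module.finrank ℂ (LinearMap.range X₂) ≤ r := by
    rcases hS X₂ hX₂ hΘX₂ hX₂Θ with h | h <;> omega
  have hsup := Submodule.finrank_sup_add_finrank_inf_eq (LinearMap.range X₁) (LinearMap.range X₂)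
  have hPle' := Submodule.finrank_mono hPle
  have hinf : LinearMap.range X₁ ⊓ LinearMap.range X₂ = ⊥ := Submodule.finrank_eq_zero.1 (by omega)
  -- (ii) the joint kernel on `Q` is `𝔊`-stable, hence zero
  set K : Submodule ℂ W := Q ⊓ LinearMap.ker X₁ ⊓ LinearMap.ker X₂ with hKdef
  have hKmem : ∀ x, x ∈ K ↔ x ∈ Q ∧ X₁ x = 0 ∧ X₂ x = 0 := fun x => by
    rw [hKdef, Submodule.mem_inf, Submodule.mem_inf, LinearMap.mem_ker, LinearMap.mem_ker, and_assoc]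
  have hKstab : ∀ A ∈ 𝔊, ∀ k ∈ K, A k ∈ K := by
    intro A hA k hk
    obtain ⟨hkQ, hk1, hk2⟩ := (hKmem k).1 hk
    obtain ⟨hdecomp, hzΘ⟩ := UnitaryThetaCore.decomp hΘΘ A
    obtain ⟨hrmem, hΘr, hrΘ⟩ := UnitaryThetaCore.raise_relations hbr hΘ hΘΘ hA
    obtain ⟨hlmem, hΘl, hlΘ⟩ := UnitaryThetaCore.lower_relations hbr hΘ hΘΘ hA
    have hzmem := UnitaryThetaCore.zero_mem hbr hΘ hΘΘ hA
    set Ar := (4 : ℂ)⁻¹ • (A + Θ * A - A * Θ - Θ * A * Θ) with hArdef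
    set Al := (4 : ℂ)⁻¹ • (A - Θ * A + A * Θ - Θ * A * Θ) with hAldef
    set Az := (2 : ℂ)⁻¹ • (A + Θ * A * Θ) with hAzdef
    -- the raising part kills `k`, the lowering part kills `Q`
    obtain ⟨a, b, hArab⟩ := hcomb Ar hrmem hΘr hrΘ
    have hArk : Ar k = 0 := by rw [hArab, LinearMap.add_apply, LinearMap.smul_apply, LinearMap.smul_apply, hk1, hk2,
      smul_zero, smul_zero, add_zero]
    have hAlk : Al k = 0 := hlowerQ Al hlΘ k hkQ
    -- the `Θ`-commuting part preserves `K`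
    have hAzQ : Az k ∈ Q := (hQ _).2 (by
      rw [← Module.End.mul_apply, hzΘ, Module.End.mul_apply, (hQ k).1 hkQ, map_neg])
    have hbrX : ∀ X : Module.End ℂ W, X ∈ 𝔊 → Θ * X = X → X * Θ = -X → X (Az k) = 0 := by
      intro X hX hΘX hXΘ
      have hmem : X * Az - Az * X ∈ 𝔊 := hbr X hX Az hzmem
      have hΘc : Θ * (X * Az - Az * X) = X * Az - Az * X := by
        rw [mul_sub, ← mul_assoc, hΘX, ← mul_assoc, hzΘ, mul_assoc, hΘX]
      have hcΘ : (X * Az - Az * X) * Θ = -(X * Az - Az * X) := by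
        rw [sub_mul, mul_assoc, ← hzΘ, ← mul_assoc, hXΘ, mul_assoc, hXΘ, neg_mul, mul_neg, neg_sub_neg, neg_sub]
      obtain ⟨a', b', hc⟩ := hcomb _ hmem hΘc hcΘ
      have hck : (X * Az - Az * X) k = 0 := by
        rw [hc, LinearMap.add_apply, LinearMap.smul_apply, LinearMap.smul_apply, hk1, hk2, smul_zero, smul_zero,
          add_zero]
      have hXk : X k = 0 := by
        obtain ⟨a'', b'', hXab⟩ := hcomb X hX hΘX hXΘ
        rw [hXab, LinearMap.add_apply, LinearMap.smul_apply, LinearMap.smul_apply, hk1, hk2, smul_zero, smul_zero,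
          add_zero]
      rw [LinearMap.sub_apply, Module.End.mul_apply, Module.End.mul_apply, hXk, map_zero, sub_zero] at hck
      exact hck
    have hAzk : Az k ∈ K := (hKmem _).2 ⟨hAzQ, hbrX X₁ hX₁ hΘX₁ hX₁Θ, hbrX X₂ hX₂ hΘX₂ hX₂Θ⟩
    have hAk : A k = Az k := by
      conv_lhs => rw [hdecomp]
      rw [LinearMap.add_apply, LinearMap.add_apply, hArk, hAlk, zero_add, zero_add]
    rw [hAk]
    exact hAzk
  have hKbot : K = ⊥ := by
    rcases hirr K hKstab with h | h
    · exact h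
    · exfalso
      obtain ⟨⟨p, hp⟩, hp0⟩ := Module.finrank_pos_iff_exists_ne_zero.1 (show 0 < Module.finrank ℂ P by omega)
      have hpK : p ∈ K := by rw [h]; exact Submodule.mem_top
      have hpQ : p ∈ Q := ((hKmem p).1 hpK).1
      have hp1 := (hP p).1 hp
      rw [(hQ p).1 hpQ] at hp1
      have h2 : (2 : ℂ) • p = 0 := by rw [two_smul]; nth_rewrite 1 [← hp1]; rw [neg_add_cancel]
      exact hp0 (Subtype.ext ((smul_eq_zero.1 h2).resolve_left two_ne_zero))
  -- (iii) `X₁ + X₂` is injective on `Q`, so its rank is `dim Q`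
  have hX : X₁ + X₂ ∈ 𝔊 := Submodule.add_mem _ hX₁ hX₂
  have hΘX : Θ * (X₁ + X₂) = X₁ + X₂ := by rw [mul_add, hΘX₁, hΘX₂]
  have hXΘ : (X₁ + X₂) * Θ = -(X₁ + X₂) := by rw [add_mul, hX₁Θ, hX₂Θ, neg_add]
  have hinj : ∀ q ∈ Q, (X₁ + X₂) q = 0 → q = 0 := by
    intro q hq h0
    rw [LinearMap.add_apply, add_eq_zero_iff_eq_neg] at h0
    have hmem : X₁ q ∈ LinearMap.range X₁ ⊓ LinearMap.range X₂ :=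
      Submodule.mem_inf.2 ⟨LinearMap.mem_range_self X₁ q, by rw [h0]; exact Submodule.neg_mem _ (LinearMap.mem_range_self X₂ q)⟩
    rw [hinf, Submodule.mem_bot] at hmem
    have h2 : X₂ q = 0 := by rw [hmem, zero_eq_neg] at h0; exact h0
    have hqK : q ∈ K := (hKmem q).2 ⟨hq, hmem, h2⟩
    rw [hKbot, Submodule.mem_bot] at hqK
    exact hqK
  have hrange : LinearMap.range (X₁ + X₂) = Q.map (X₁ + X₂) := by
    refine le_antisymm ?_ LinearMap.map_le_range
    rintro _ ⟨w, rfl⟩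
    have hq : (2 : ℂ)⁻¹ • (w - Θ w) ∈ Q := (hQ _).2 (by rw [map_smul, map_sub, hΘΘv, ← smul_neg, neg_sub])
    have hp : (2 : ℂ)⁻¹ • (w + Θ w) ∈ P := (hP _).2 (by rw [map_smul, map_add, hΘΘv, add_comm])
    refine ⟨_, hq, ?_⟩
    have hw : (2 : ℂ)⁻¹ • (w + Θ w) + (2 : ℂ)⁻¹ • (w - Θ w) = w := by module
    conv_rhs => rw [← hw, map_add, hraiseP _ hXΘ _ hp, zero_add]
  have hker : LinearMap.ker ((X₁ + X₂).domRestrict Q) = ⊥ := by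
    rw [LinearMap.ker_eq_bot']
    intro q hq
    exact Subtype.ext (hinj q q.2 hq)
  have hrk := LinearMap.finrank_range_add_finrank_ker ((X₁ + X₂).domRestrict Q)
  rw [LinearMap.range_domRestrict, ← hrange, hker, finrank_bot, add_zero] at hrk
  rcases hS _ hX hΘX hXΘ with h | h <;> omega

/-- **Three independent raising operators** in an irreducible unitary algebra whose non-zero raising operators have
constant rank `r`, with `dim P = 2r > 0` and `0 < dim Q ≠ r` (e.g. type `(6 | 4)` with constant raising rank `3`).
[cite: Gordon1997, §6 (proof of Thm. 6.3.3, p. 19)] [cite: Ribet1983, Thm. 3] [cite: GoodmanWallachGTM255, §4.1.1] -/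
theorem UnitaryConstantRank.exists_three_raise_linearIndependent [FiniteDimensional ℂ W]
    {𝔊 : Submodule ℂ (Module.End ℂ W)}
    (hbr : ∀ Y ∈ 𝔊, ∀ Z ∈ 𝔊, Y * Z - Z * Y ∈ 𝔊)
    (hirr : ∀ U : Submodule ℂ W, (∀ A ∈ 𝔊, ∀ u ∈ U, A u ∈ U) → U = ⊥ ∨ U = ⊤)
    {Θ : Module.End ℂ W} (hΘ : Θ ∈ 𝔊) (hΘΘ : Θ * Θ = 1)
    {P Q : Submodule ℂ W} (hP : ∀ x, x ∈ P ↔ Θ x = x) (hQ : ∀ x, x ∈ Q ↔ Θ x = -x)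
    {r : ℕ} (hr : 0 < r) (hPr : Module.finrank ℂ P = r + r) (hQ0 : 0 < Module.finrank ℂ Q)
    (hQr : Module.finrank ℂ Q ≠ r)
    (hS : ∀ Y ∈ 𝔊, Θ * Y = Y → Y * Θ = -Y →
      Module.finrank ℂ (LinearMap.range Y) = 0 ∨ Module.finrank ℂ (LinearMap.range Y) = r) :
    ∃ X : Fin 3 → Module.End ℂ W, (∀ k, X k ∈ 𝔊 ∧ Θ * X k = X k ∧ X k * Θ = -(X k)) ∧ LinearIndependent ℂ X := by
  have h0 : (0 : Module.End ℂ W) ∈ 𝔊 ∧ Θ * 0 = 0 ∧ (0 : Module.End ℂ W) * Θ = -0 :=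
    ⟨Submodule.zero_mem _, mul_zero Θ, by rw [zero_mul, neg_zero]⟩
  obtain ⟨X₁, hX₁, hΘX₁, hX₁Θ, hX₁n⟩ := UnitaryConstantRank.exists_raise_not_mem_span_pair hbr hirr hΘ hΘΘ hP hQ hr hPr
    hQ0 hQr hS h0.1 h0.2.1 h0.2.2 h0.1 h0.2.1 h0.2.2
  obtain ⟨X₂, hX₂, hΘX₂, hX₂Θ, hX₂n⟩ := UnitaryConstantRank.exists_raise_not_mem_span_pair hbr hirr hΘ hΘΘ hP hQ hr hPr
    hQ0 hQr hS hX₁ hΘX₁ hX₁Θ h0.1 h0.2.1 h0.2.2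
  obtain ⟨X₃, hX₃, hΘX₃, hX₃Θ, hX₃n⟩ := UnitaryConstantRank.exists_raise_not_mem_span_pair hbr hirr hΘ hΘΘ hP hQ hr hPr
    hQ0 hQr hS hX₁ hΘX₁ hX₁Θ hX₂ hΘX₂ hX₂Θ
  have hX₁0 : X₁ ≠ 0 := fun h => hX₁n (by rw [h]; exact Submodule.zero_mem _)
  refine ⟨![X₃, X₂, X₁], fun k => ?_, ?_⟩
  · fin_cases k
    exacts [⟨hX₃, hΘX₃, hX₃Θ⟩, ⟨hX₂, hΘX₂, hX₂Θ⟩, ⟨hX₁, hΘX₁, hX₁Θ⟩]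
  have htail : Fin.tail ![X₃, X₂, X₁] = ![X₂, X₁] := by
    ext i
    fin_cases i <;> rfl
  have hle : Submodule.span ℂ (Set.range ![X₂, X₁]) ≤ Submodule.span ℂ {X₁, X₂} := by
    refine Submodule.span_le.2 ?_
    rintro _ ⟨i, rfl⟩
    fin_cases i
    · exact Submodule.subset_span (Set.mem_insert_of_mem _ rfl)
    · exact Submodule.subset_span (Set.mem_insert _ _)
  rw [linearIndependent_finSucc, htail, linearIndependent_fin2]
  refine ⟨⟨hX₁0, fun a ha => hX₂n ?_⟩, fun hmem => hX₃n (hle hmem)⟩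
  have ha' : a • X₁ = X₂ := ha
  rw [← ha']
  exact Submodule.smul_mem _ _ (Submodule.subset_span (Set.mem_insert _ _))

end HodgeStructure

end Literature.AlgebraicGeometry.Motives

end
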